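import Mathlib
import HarnessLib
import Summits.NavierStokesRegularity.NavierStokesRegularity.Theorems.PoloidalWindowDoorPoloidalWindowRigidityLocalThickTHOfLocalOpen

/-!
# Crux `PoloidalWindowRigidity` (K2, stmt-NavierStokesRegularity-19708) — closing the circle of local THICK statements:
# S2 `stub_localThickTH` ⇒ `hthick` ⇒ `hleaf` (so, with the landed converses, S2 ⇔ hthick ⇔ hleaf in the tree)

Cell ns-regularity-ideate, seat ns-poloidal-K2-p4 gen 0 (THICK column; lead ns-poloidal-K2-p2; `--supports stmt-NavierStokesRegularity-19708` helper).
The tree has `hleaf ⇒ hthick` (`…TwistingThickLeafwise.localThickOpen_of_localThickLeaf`), `hthick ⇒ S2` and `hleaf ⇒ S2` (`…LocalThickTHOfLocalOpen`),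
and `S2 ⇒` every registered THICK stub.  This file supplies the two remaining arrows, so that the three «dresses» of the (R-THICK) local statement are
literally equivalent tree-side:

* `localThickOpen_of_localThickTH` — **S2 ⇒ hthick**: a germ as in `hthick` (analytic classical NS pair on an open `U`, everywhere poloidal, frozen,
  non-degenerate, twisting, `∇ₕΛ ≠ 0`) gets from S2 a time–height sub-window `U₁` with slope `m(t, y₂)`; there the ratio `Λ(t,·)` equals `m(t, y₂)`
  (`eq_ratio_mul_of_frozen`: the ratio is the unique slope where `∇ₕu₂ ≠ 0`), so along the horizontal lines `s ↦ y + s e_b` (`b = 0,1`) it is constant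
  and its horizontal partial derivatives vanish (chain rule along the line; `Λ(t,·)` is differentiable, being a quotient of analytic Jacobian entries) —
  contradicting `∇ₕΛ ≠ 0`.  No regularity of `m` is needed.
* `localThickLeaf_of_localThickOpen` — **hthick ⇒ hleaf** (if `∂ₙΛ = ∂₀Λ·∂₀u₂ + ∂₁Λ·∂₁u₂ ≠ 0` then `∇ₕΛ ≠ 0`);
* `localThickLeaf_of_localThickTH` — **S2 ⇒ hleaf** (composition).

WHAT THIS IS NOT: not a proof of any of the three statements (the (R-THICK) research residue), nor of anything about Navier–Stokes regularity — bookkeeping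
that makes «S2 ⇔ hthick ⇔ hleaf» a tree fact.  bears_on LADDER-NS N0, crux 19708 (local_rigidity S2; mixed_type `stub_hyperbolicThick`), item 20428.
-/

noncomputable section

-- the summit and its single sub-problem share the name (CONVENTIONS §1), as in every Theorems file
set_option linter.dupNamespace false

namespace Summit.NavierStokesRegularity.NavierStokesRegularity.Theorems.PoloidalWindowDoorPoloidalWindowRigidityLocalThickLeafOfLocalThickTH

open Set Function Metric Filter
open scoped RealInnerProductSpace InnerProductSpace Topology
open Literature.Analysis Literature.Analysis.FluidPDE
open Summit.NavierStokesRegularity.NavierStokesRegularity.Theorems.PoloidalWindowDoorPoloidalWindowRigidityHyperbolicThickOfLocalOpen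

/-- **S2 `stub_localThickTH` ⇒ `hthick`.** -/
theorem localThickOpen_of_localThickTH
    (hS2 :     ∀ (u : ℝ → EuclideanSpace ℝ (Fin 3) → EuclideanSpace ℝ (Fin 3)) (q : ℝ → EuclideanSpace ℝ (Fin 3) → ℝ)
      (U : Set (ℝ × EuclideanSpace ℝ (Fin 3))),
      IsOpen U → U.Nonempty →
      Literature.Analysis.FluidPDE.IsClassicalNSSolutionOnRegion U 1 0 u q →
      AnalyticOnNhd ℝ (Function.uncurry u) U →
      (∀ p ∈ U, ⟪Literature.Analysis.FluidPDE.curl (u p.1) p.2, EuclideanSpace.single 2 1⟫_ℝ = 0) →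
      (∀ p ∈ U, Literature.Analysis.FluidPDE.curl (u p.1) p.2 ≠ 0 ∧
        (fderiv ℝ (u p.1) p.2 (EuclideanSpace.single 0 1) 2 ≠ 0 ∨ fderiv ℝ (u p.1) p.2 (EuclideanSpace.single 1 1) 2 ≠ 0) ∧
        (fderiv ℝ (u p.1) p.2 (EuclideanSpace.single 2 1) 0 ≠ 0 ∨ fderiv ℝ (u p.1) p.2 (EuclideanSpace.single 2 1) 1 ≠ 0)) →
      (∀ p ∈ U,
        fderiv ℝ (fun y => fderiv ℝ (u p.1) y (EuclideanSpace.single 2 1) 2) p.2 (EuclideanSpace.single 0 1) *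
            fderiv ℝ (u p.1) p.2 (EuclideanSpace.single 1 1) 2 -
          fderiv ℝ (fun y => fderiv ℝ (u p.1) y (EuclideanSpace.single 2 1) 2) p.2 (EuclideanSpace.single 1 1) *
            fderiv ℝ (u p.1) p.2 (EuclideanSpace.single 0 1) 2 ≠ 0) →
      ∃ U₁ : Set (ℝ × EuclideanSpace ℝ (Fin 3)), U₁ ⊆ U ∧ IsOpen U₁ ∧ U₁.Nonempty ∧
        ∃ m : ℝ → ℝ → ℝ, ∀ p ∈ U₁, ∀ b : Fin 3, b ≠ 2 →
          fderiv ℝ (u p.1) p.2 (EuclideanSpace.single 2 1) b =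
            m p.1 (p.2 2) * fderiv ℝ (u p.1) p.2 (EuclideanSpace.single b 1) 2) :
    ∀ (u : ℝ → EuclideanSpace ℝ (Fin 3) → EuclideanSpace ℝ (Fin 3)) (q : ℝ → EuclideanSpace ℝ (Fin 3) → ℝ)
        (U : Set (ℝ × EuclideanSpace ℝ (Fin 3))),
        IsOpen U → U.Nonempty →
        Literature.Analysis.FluidPDE.IsClassicalNSSolutionOnRegion U 1 0 u q →
        AnalyticOnNhd ℝ (Function.uncurry u) U →
        (∀ p ∈ U, ⟪Literature.Analysis.FluidPDE.curl (u p.1) p.2, EuclideanSpace.single 2 1⟫_ℝ = 0) →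
        (∀ p ∈ U, fderiv ℝ (u p.1) p.2 (EuclideanSpace.single 2 1) 0 * fderiv ℝ (u p.1) p.2 (EuclideanSpace.single 1 1) 2 =
          fderiv ℝ (u p.1) p.2 (EuclideanSpace.single 2 1) 1 * fderiv ℝ (u p.1) p.2 (EuclideanSpace.single 0 1) 2) →
        (∀ p ∈ U, Literature.Analysis.FluidPDE.curl (u p.1) p.2 ≠ 0 ∧
          (fderiv ℝ (u p.1) p.2 (EuclideanSpace.single 0 1) 2 ≠ 0 ∨ fderiv ℝ (u p.1) p.2 (EuclideanSpace.single 1 1) 2 ≠ 0) ∧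
          (fderiv ℝ (u p.1) p.2 (EuclideanSpace.single 2 1) 0 ≠ 0 ∨ fderiv ℝ (u p.1) p.2 (EuclideanSpace.single 2 1) 1 ≠ 0)) →
        (∀ p ∈ U,
          fderiv ℝ (fun y => fderiv ℝ (u p.1) y (EuclideanSpace.single 2 1) 2) p.2 (EuclideanSpace.single 0 1) *
              fderiv ℝ (u p.1) p.2 (EuclideanSpace.single 1 1) 2 -
            fderiv ℝ (fun y => fderiv ℝ (u p.1) y (EuclideanSpace.single 2 1) 2) p.2 (EuclideanSpace.single 1 1) *
              fderiv ℝ (u p.1) p.2 (EuclideanSpace.single 0 1) 2 ≠ 0) →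
        (∀ p ∈ U,
          fderiv ℝ (fun y => (fderiv ℝ (u p.1) y (EuclideanSpace.single 2 1) 0 * fderiv ℝ (u p.1) y (EuclideanSpace.single 0 1) 2 +
              fderiv ℝ (u p.1) y (EuclideanSpace.single 2 1) 1 * fderiv ℝ (u p.1) y (EuclideanSpace.single 1 1) 2) /
            (fderiv ℝ (u p.1) y (EuclideanSpace.single 0 1) 2 ^ 2 + fderiv ℝ (u p.1) y (EuclideanSpace.single 1 1) 2 ^ 2)) p.2 (EuclideanSpace.single 0 1) ≠ 0 ∨
          fderiv ℝ (fun y => (fderiv ℝ (u p.1) y (EuclideanSpace.single 2 1) 0 * fderiv ℝ (u p.1) y (EuclideanSpace.single 0 1) 2 +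
              fderiv ℝ (u p.1) y (EuclideanSpace.single 2 1) 1 * fderiv ℝ (u p.1) y (EuclideanSpace.single 1 1) 2) /
            (fderiv ℝ (u p.1) y (EuclideanSpace.single 0 1) 2 ^ 2 + fderiv ℝ (u p.1) y (EuclideanSpace.single 1 1) 2 ^ 2)) p.2 (EuclideanSpace.single 1 1) ≠ 0) →
        False := by
  intro u q U hU hUne hreg han hpol hfr hnd htw hpin
  obtain ⟨U₁, hU₁U, hU₁o, ⟨p, hp⟩, m, hm⟩ := hS2 u q U hU hUne hreg han hpol hnd htw
  have hpU : p ∈ U := hU₁U hp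
  -- the ratio on the slice `t = p.1` and its differentiability at `p.2`
  set Λ : EuclideanSpace ℝ (Fin 3) → ℝ := fun y =>
    (fderiv ℝ (u p.1) y (EuclideanSpace.single 2 1) 0 * fderiv ℝ (u p.1) y (EuclideanSpace.single 0 1) 2 +
        fderiv ℝ (u p.1) y (EuclideanSpace.single 2 1) 1 * fderiv ℝ (u p.1) y (EuclideanSpace.single 1 1) 2) /
      (fderiv ℝ (u p.1) y (EuclideanSpace.single 0 1) 2 ^ 2 + fderiv ℝ (u p.1) y (EuclideanSpace.single 1 1) 2 ^ 2) with hΛ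
  have hent : ∀ j i : Fin 3, AnalyticAt ℝ (fun y => fderiv ℝ (u p.1) y (EuclideanSpace.single j 1) i) p.2 := by
    intro j i
    have h := analyticAt_uncurry_fderiv_slice_apply (han p hpU) (EuclideanSpace.single j 1)
    have e : (fun y => fderiv ℝ (u p.1) y (EuclideanSpace.single j 1) i) =
        (EuclideanSpace.proj i : EuclideanSpace ℝ (Fin 3) →L[ℝ] ℝ) ∘
          (fun y => fderiv ℝ (u p.1) y (EuclideanSpace.single j 1)) := by
      funext y; rfl
    rw [e]
    exact ((EuclideanSpace.proj i : EuclideanSpace ℝ (Fin 3) →L[ℝ] ℝ).analyticAt _).comp (analyticAt_slice h)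
  have hden : fderiv ℝ (u p.1) p.2 (EuclideanSpace.single 0 1) 2 ^ 2 + fderiv ℝ (u p.1) p.2 (EuclideanSpace.single 1 1) 2 ^ 2 ≠ 0 := by
    rcases (hnd p hpU).2.1 with h | h
    · have h' : 0 < fderiv ℝ (u p.1) p.2 (EuclideanSpace.single 0 1) 2 ^ 2 := by positivity
      have := sq_nonneg (fderiv ℝ (u p.1) p.2 (EuclideanSpace.single 1 1) 2)
      exact ne_of_gt (by linarith)
    · have h' : 0 < fderiv ℝ (u p.1) p.2 (EuclideanSpace.single 1 1) 2 ^ 2 := by positivity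
      have := sq_nonneg (fderiv ℝ (u p.1) p.2 (EuclideanSpace.single 0 1) 2)
      exact ne_of_gt (by linarith)
  have hΛd : DifferentiableAt ℝ Λ p.2 := by
    have hnum : AnalyticAt ℝ (fun y =>
        fderiv ℝ (u p.1) y (EuclideanSpace.single 2 1) 0 * fderiv ℝ (u p.1) y (EuclideanSpace.single 0 1) 2 +
          fderiv ℝ (u p.1) y (EuclideanSpace.single 2 1) 1 * fderiv ℝ (u p.1) y (EuclideanSpace.single 1 1) 2) p.2 :=
      ((hent 2 0).mul (hent 0 2)).add ((hent 2 1).mul (hent 1 2))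
    have hden' : AnalyticAt ℝ (fun y => fderiv ℝ (u p.1) y (EuclideanSpace.single 0 1) 2 ^ 2 +
        fderiv ℝ (u p.1) y (EuclideanSpace.single 1 1) 2 ^ 2) p.2 := ((hent 0 2).pow 2).add ((hent 1 2).pow 2)
    exact (hnum.div hden' hden).differentiableAt
  -- on `U₁`, the ratio is the time–height slope: `Λ y = m (p.1) (y 2)`
  have hsec : ∀ᶠ y in 𝓝 p.2, (p.1, y) ∈ U₁ :=
    (hU₁o.preimage (Continuous.prodMk_right p.1)).mem_nhds (by simpa using hp)
  have hΛm : ∀ y, (p.1, y) ∈ U₁ → Λ y = m p.1 (y 2) := by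
    intro y hy
    have hyU : (p.1, y) ∈ U := hU₁U hy
    have h0 := hm (p.1, y) hy 0 (by decide)
    have h1 := hm (p.1, y) hy 1 (by decide)
    have hr := eq_ratio_mul_of_frozen (hfr (p.1, y) hyU) (hnd (p.1, y) hyU).2.1
    simp only at h0 h1 hr
    -- `∂₂u_b = Λ ∂_bu₂` and `∂₂u_b = m ∂_bu₂` with `∇ₕu₂ ≠ 0` force `Λ = m`
    rcases (hnd (p.1, y) hyU).2.1 with hne | hne
    · have e : Λ y * fderiv ℝ (u p.1) y (EuclideanSpace.single 0 1) 2 =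
          m p.1 (y 2) * fderiv ℝ (u p.1) y (EuclideanSpace.single 0 1) 2 := by rw [← h0, hΛ]; exact hr.1.symm
      exact mul_right_cancel₀ hne e
    · have e : Λ y * fderiv ℝ (u p.1) y (EuclideanSpace.single 1 1) 2 =
          m p.1 (y 2) * fderiv ℝ (u p.1) y (EuclideanSpace.single 1 1) 2 := by rw [← h1, hΛ]; exact hr.2.symm
      exact mul_right_cancel₀ hne e
  -- hence the horizontal partial derivatives of `Λ` vanish at `p.2` (constant along horizontal lines)
  have hzero : ∀ b : Fin 3, b ≠ 2 → fderiv ℝ Λ p.2 (EuclideanSpace.single b 1) = 0 := by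
    intro b hb
    -- the line `s ↦ p.2 + s • e_b`
    have hline : HasDerivAt (fun s : ℝ => p.2 + s • (EuclideanSpace.single b (1 : ℝ) : EuclideanSpace ℝ (Fin 3)))
        (EuclideanSpace.single b (1 : ℝ)) 0 := by
      have h := ((hasDerivAt_id (0 : ℝ)).smul_const (EuclideanSpace.single b (1 : ℝ) : EuclideanSpace ℝ (Fin 3))).const_add p.2
      simpa using h
    have h := hΛd.hasFDerivAt.comp_hasDerivAt_of_eq (0 : ℝ) hline (by simp)
    -- along the line the ratio is constant near `s = 0`
    have htend : Tendsto (fun s : ℝ => p.2 + s • (EuclideanSpace.single b (1 : ℝ) : EuclideanSpace ℝ (Fin 3))) (𝓝 0) (𝓝 p.2) := by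
      have := hline.continuousAt.tendsto
      simpa using this
    have hev : (Λ ∘ fun s : ℝ => p.2 + s • (EuclideanSpace.single b (1 : ℝ) : EuclideanSpace ℝ (Fin 3))) =ᶠ[𝓝 (0 : ℝ)]
        fun _ => m p.1 (p.2 2) := by
      filter_upwards [htend.eventually hsec] with s hs
      simp only [Function.comp_apply]
      rw [hΛm _ hs]
      simp [hb.symm]
    have h2 := h.congr_of_eventuallyEq hev.symm
    exact h2.unique (hasDerivAt_const (0 : ℝ) (m p.1 (p.2 2)))
  rcases hpin p hpU with h | h
  · exact h (hzero 0 (by decide))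
  · exact h (hzero 1 (by decide))

/-- **`hthick` ⇒ `hleaf`** (`∂ₙΛ ≠ 0` forces `∇ₕΛ ≠ 0`). -/
theorem localThickLeaf_of_localThickOpen
    (hthick : ∀ (u : ℝ → EuclideanSpace ℝ (Fin 3) → EuclideanSpace ℝ (Fin 3)) (q : ℝ → EuclideanSpace ℝ (Fin 3) → ℝ)
        (U : Set (ℝ × EuclideanSpace ℝ (Fin 3))),
        IsOpen U → U.Nonempty →
        Literature.Analysis.FluidPDE.IsClassicalNSSolutionOnRegion U 1 0 u q →
        AnalyticOnNhd ℝ (Function.uncurry u) U →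
        (∀ p ∈ U, ⟪Literature.Analysis.FluidPDE.curl (u p.1) p.2, EuclideanSpace.single 2 1⟫_ℝ = 0) →
        (∀ p ∈ U, fderiv ℝ (u p.1) p.2 (EuclideanSpace.single 2 1) 0 * fderiv ℝ (u p.1) p.2 (EuclideanSpace.single 1 1) 2 =
          fderiv ℝ (u p.1) p.2 (EuclideanSpace.single 2 1) 1 * fderiv ℝ (u p.1) p.2 (EuclideanSpace.single 0 1) 2) →
        (∀ p ∈ U, Literature.Analysis.FluidPDE.curl (u p.1) p.2 ≠ 0 ∧
          (fderiv ℝ (u p.1) p.2 (EuclideanSpace.single 0 1) 2 ≠ 0 ∨ fderiv ℝ (u p.1) p.2 (EuclideanSpace.single 1 1) 2 ≠ 0) ∧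
          (fderiv ℝ (u p.1) p.2 (EuclideanSpace.single 2 1) 0 ≠ 0 ∨ fderiv ℝ (u p.1) p.2 (EuclideanSpace.single 2 1) 1 ≠ 0)) →
        (∀ p ∈ U,
          fderiv ℝ (fun y => fderiv ℝ (u p.1) y (EuclideanSpace.single 2 1) 2) p.2 (EuclideanSpace.single 0 1) *
              fderiv ℝ (u p.1) p.2 (EuclideanSpace.single 1 1) 2 -
            fderiv ℝ (fun y => fderiv ℝ (u p.1) y (EuclideanSpace.single 2 1) 2) p.2 (EuclideanSpace.single 1 1) *
              fderiv ℝ (u p.1) p.2 (EuclideanSpace.single 0 1) 2 ≠ 0) →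
        (∀ p ∈ U,
          fderiv ℝ (fun y => (fderiv ℝ (u p.1) y (EuclideanSpace.single 2 1) 0 * fderiv ℝ (u p.1) y (EuclideanSpace.single 0 1) 2 +
              fderiv ℝ (u p.1) y (EuclideanSpace.single 2 1) 1 * fderiv ℝ (u p.1) y (EuclideanSpace.single 1 1) 2) /
            (fderiv ℝ (u p.1) y (EuclideanSpace.single 0 1) 2 ^ 2 + fderiv ℝ (u p.1) y (EuclideanSpace.single 1 1) 2 ^ 2)) p.2 (EuclideanSpace.single 0 1) ≠ 0 ∨
          fderiv ℝ (fun y => (fderiv ℝ (u p.1) y (EuclideanSpace.single 2 1) 0 * fderiv ℝ (u p.1) y (EuclideanSpace.single 0 1) 2 +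
              fderiv ℝ (u p.1) y (EuclideanSpace.single 2 1) 1 * fderiv ℝ (u p.1) y (EuclideanSpace.single 1 1) 2) /
            (fderiv ℝ (u p.1) y (EuclideanSpace.single 0 1) 2 ^ 2 + fderiv ℝ (u p.1) y (EuclideanSpace.single 1 1) 2 ^ 2)) p.2 (EuclideanSpace.single 1 1) ≠ 0) →
        False) :
    ∀ (u : ℝ → EuclideanSpace ℝ (Fin 3) → EuclideanSpace ℝ (Fin 3)) (q : ℝ → EuclideanSpace ℝ (Fin 3) → ℝ)
        (U : Set (ℝ × EuclideanSpace ℝ (Fin 3))),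
        IsOpen U → U.Nonempty →
        Literature.Analysis.FluidPDE.IsClassicalNSSolutionOnRegion U 1 0 u q →
        AnalyticOnNhd ℝ (Function.uncurry u) U →
        (∀ p ∈ U, ⟪Literature.Analysis.FluidPDE.curl (u p.1) p.2, EuclideanSpace.single 2 1⟫_ℝ = 0) →
        (∀ p ∈ U, fderiv ℝ (u p.1) p.2 (EuclideanSpace.single 2 1) 0 * fderiv ℝ (u p.1) p.2 (EuclideanSpace.single 1 1) 2 =
          fderiv ℝ (u p.1) p.2 (EuclideanSpace.single 2 1) 1 * fderiv ℝ (u p.1) p.2 (EuclideanSpace.single 0 1) 2) →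
        (∀ p ∈ U, Literature.Analysis.FluidPDE.curl (u p.1) p.2 ≠ 0 ∧
          (fderiv ℝ (u p.1) p.2 (EuclideanSpace.single 0 1) 2 ≠ 0 ∨ fderiv ℝ (u p.1) p.2 (EuclideanSpace.single 1 1) 2 ≠ 0) ∧
          (fderiv ℝ (u p.1) p.2 (EuclideanSpace.single 2 1) 0 ≠ 0 ∨ fderiv ℝ (u p.1) p.2 (EuclideanSpace.single 2 1) 1 ≠ 0)) →
        (∀ p ∈ U,
          fderiv ℝ (fun y => fderiv ℝ (u p.1) y (EuclideanSpace.single 2 1) 2) p.2 (EuclideanSpace.single 0 1) *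
              fderiv ℝ (u p.1) p.2 (EuclideanSpace.single 1 1) 2 -
            fderiv ℝ (fun y => fderiv ℝ (u p.1) y (EuclideanSpace.single 2 1) 2) p.2 (EuclideanSpace.single 1 1) *
              fderiv ℝ (u p.1) p.2 (EuclideanSpace.single 0 1) 2 ≠ 0) →
        (∀ p ∈ U,
          fderiv ℝ (fun y => (fderiv ℝ (u p.1) y (EuclideanSpace.single 2 1) 0 * fderiv ℝ (u p.1) y (EuclideanSpace.single 0 1) 2 +
              fderiv ℝ (u p.1) y (EuclideanSpace.single 2 1) 1 * fderiv ℝ (u p.1) y (EuclideanSpace.single 1 1) 2) /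
            (fderiv ℝ (u p.1) y (EuclideanSpace.single 0 1) 2 ^ 2 + fderiv ℝ (u p.1) y (EuclideanSpace.single 1 1) 2 ^ 2)) p.2 (EuclideanSpace.single 0 1) * fderiv ℝ (u p.1) p.2 (EuclideanSpace.single 1 1) 2 =
          fderiv ℝ (fun y => (fderiv ℝ (u p.1) y (EuclideanSpace.single 2 1) 0 * fderiv ℝ (u p.1) y (EuclideanSpace.single 0 1) 2 +
              fderiv ℝ (u p.1) y (EuclideanSpace.single 2 1) 1 * fderiv ℝ (u p.1) y (EuclideanSpace.single 1 1) 2) /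
            (fderiv ℝ (u p.1) y (EuclideanSpace.single 0 1) 2 ^ 2 + fderiv ℝ (u p.1) y (EuclideanSpace.single 1 1) 2 ^ 2)) p.2 (EuclideanSpace.single 1 1) * fderiv ℝ (u p.1) p.2 (EuclideanSpace.single 0 1) 2) →
        (∀ p ∈ U,
          fderiv ℝ (fun y => (fderiv ℝ (u p.1) y (EuclideanSpace.single 2 1) 0 * fderiv ℝ (u p.1) y (EuclideanSpace.single 0 1) 2 +
              fderiv ℝ (u p.1) y (EuclideanSpace.single 2 1) 1 * fderiv ℝ (u p.1) y (EuclideanSpace.single 1 1) 2) /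
            (fderiv ℝ (u p.1) y (EuclideanSpace.single 0 1) 2 ^ 2 + fderiv ℝ (u p.1) y (EuclideanSpace.single 1 1) 2 ^ 2)) p.2 (EuclideanSpace.single 0 1) * fderiv ℝ (u p.1) p.2 (EuclideanSpace.single 0 1) 2 +
          fderiv ℝ (fun y => (fderiv ℝ (u p.1) y (EuclideanSpace.single 2 1) 0 * fderiv ℝ (u p.1) y (EuclideanSpace.single 0 1) 2 +
              fderiv ℝ (u p.1) y (EuclideanSpace.single 2 1) 1 * fderiv ℝ (u p.1) y (EuclideanSpace.single 1 1) 2) /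
            (fderiv ℝ (u p.1) y (EuclideanSpace.single 0 1) 2 ^ 2 + fderiv ℝ (u p.1) y (EuclideanSpace.single 1 1) 2 ^ 2)) p.2 (EuclideanSpace.single 1 1) * fderiv ℝ (u p.1) p.2 (EuclideanSpace.single 1 1) 2 ≠ 0) →
        False := by
  intro u q U hU hUne hreg han hpol hfr hnd htw _hleafw hdn
  refine hthick u q U hU hUne hreg han hpol hfr hnd htw fun p hp => ?_
  by_contra h
  push Not at h
  apply hdn p hp
  rw [h.1, h.2]; ring

/-- **S2 ⇒ `hleaf`.** -/
theorem localThickLeaf_of_localThickTH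
    (hS2 :     ∀ (u : ℝ → EuclideanSpace ℝ (Fin 3) → EuclideanSpace ℝ (Fin 3)) (q : ℝ → EuclideanSpace ℝ (Fin 3) → ℝ)
      (U : Set (ℝ × EuclideanSpace ℝ (Fin 3))),
      IsOpen U → U.Nonempty →
      Literature.Analysis.FluidPDE.IsClassicalNSSolutionOnRegion U 1 0 u q →
      AnalyticOnNhd ℝ (Function.uncurry u) U →
      (∀ p ∈ U, ⟪Literature.Analysis.FluidPDE.curl (u p.1) p.2, EuclideanSpace.single 2 1⟫_ℝ = 0) →
      (∀ p ∈ U, Literature.Analysis.FluidPDE.curl (u p.1) p.2 ≠ 0 ∧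
        (fderiv ℝ (u p.1) p.2 (EuclideanSpace.single 0 1) 2 ≠ 0 ∨ fderiv ℝ (u p.1) p.2 (EuclideanSpace.single 1 1) 2 ≠ 0) ∧
        (fderiv ℝ (u p.1) p.2 (EuclideanSpace.single 2 1) 0 ≠ 0 ∨ fderiv ℝ (u p.1) p.2 (EuclideanSpace.single 2 1) 1 ≠ 0)) →
      (∀ p ∈ U,
        fderiv ℝ (fun y => fderiv ℝ (u p.1) y (EuclideanSpace.single 2 1) 2) p.2 (EuclideanSpace.single 0 1) *
            fderiv ℝ (u p.1) p.2 (EuclideanSpace.single 1 1) 2 -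
          fderiv ℝ (fun y => fderiv ℝ (u p.1) y (EuclideanSpace.single 2 1) 2) p.2 (EuclideanSpace.single 1 1) *
            fderiv ℝ (u p.1) p.2 (EuclideanSpace.single 0 1) 2 ≠ 0) →
      ∃ U₁ : Set (ℝ × EuclideanSpace ℝ (Fin 3)), U₁ ⊆ U ∧ IsOpen U₁ ∧ U₁.Nonempty ∧
        ∃ m : ℝ → ℝ → ℝ, ∀ p ∈ U₁, ∀ b : Fin 3, b ≠ 2 →
          fderiv ℝ (u p.1) p.2 (EuclideanSpace.single 2 1) b =
            m p.1 (p.2 2) * fderiv ℝ (u p.1) p.2 (EuclideanSpace.single b 1) 2) :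
    ∀ (u : ℝ → EuclideanSpace ℝ (Fin 3) → EuclideanSpace ℝ (Fin 3)) (q : ℝ → EuclideanSpace ℝ (Fin 3) → ℝ)
        (U : Set (ℝ × EuclideanSpace ℝ (Fin 3))),
        IsOpen U → U.Nonempty →
        Literature.Analysis.FluidPDE.IsClassicalNSSolutionOnRegion U 1 0 u q →
        AnalyticOnNhd ℝ (Function.uncurry u) U →
        (∀ p ∈ U, ⟪Literature.Analysis.FluidPDE.curl (u p.1) p.2, EuclideanSpace.single 2 1⟫_ℝ = 0) →
        (∀ p ∈ U, fderiv ℝ (u p.1) p.2 (EuclideanSpace.single 2 1) 0 * fderiv ℝ (u p.1) p.2 (EuclideanSpace.single 1 1) 2 =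
          fderiv ℝ (u p.1) p.2 (EuclideanSpace.single 2 1) 1 * fderiv ℝ (u p.1) p.2 (EuclideanSpace.single 0 1) 2) →
        (∀ p ∈ U, Literature.Analysis.FluidPDE.curl (u p.1) p.2 ≠ 0 ∧
          (fderiv ℝ (u p.1) p.2 (EuclideanSpace.single 0 1) 2 ≠ 0 ∨ fderiv ℝ (u p.1) p.2 (EuclideanSpace.single 1 1) 2 ≠ 0) ∧
          (fderiv ℝ (u p.1) p.2 (EuclideanSpace.single 2 1) 0 ≠ 0 ∨ fderiv ℝ (u p.1) p.2 (EuclideanSpace.single 2 1) 1 ≠ 0)) →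
        (∀ p ∈ U,
          fderiv ℝ (fun y => fderiv ℝ (u p.1) y (EuclideanSpace.single 2 1) 2) p.2 (EuclideanSpace.single 0 1) *
              fderiv ℝ (u p.1) p.2 (EuclideanSpace.single 1 1) 2 -
            fderiv ℝ (fun y => fderiv ℝ (u p.1) y (EuclideanSpace.single 2 1) 2) p.2 (EuclideanSpace.single 1 1) *
              fderiv ℝ (u p.1) p.2 (EuclideanSpace.single 0 1) 2 ≠ 0) →
        (∀ p ∈ U,
          fderiv ℝ (fun y => (fderiv ℝ (u p.1) y (EuclideanSpace.single 2 1) 0 * fderiv ℝ (u p.1) y (EuclideanSpace.single 0 1) 2 +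
              fderiv ℝ (u p.1) y (EuclideanSpace.single 2 1) 1 * fderiv ℝ (u p.1) y (EuclideanSpace.single 1 1) 2) /
            (fderiv ℝ (u p.1) y (EuclideanSpace.single 0 1) 2 ^ 2 + fderiv ℝ (u p.1) y (EuclideanSpace.single 1 1) 2 ^ 2)) p.2 (EuclideanSpace.single 0 1) * fderiv ℝ (u p.1) p.2 (EuclideanSpace.single 1 1) 2 =
          fderiv ℝ (fun y => (fderiv ℝ (u p.1) y (EuclideanSpace.single 2 1) 0 * fderiv ℝ (u p.1) y (EuclideanSpace.single 0 1) 2 +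
              fderiv ℝ (u p.1) y (EuclideanSpace.single 2 1) 1 * fderiv ℝ (u p.1) y (EuclideanSpace.single 1 1) 2) /
            (fderiv ℝ (u p.1) y (EuclideanSpace.single 0 1) 2 ^ 2 + fderiv ℝ (u p.1) y (EuclideanSpace.single 1 1) 2 ^ 2)) p.2 (EuclideanSpace.single 1 1) * fderiv ℝ (u p.1) p.2 (EuclideanSpace.single 0 1) 2) →
        (∀ p ∈ U,
          fderiv ℝ (fun y => (fderiv ℝ (u p.1) y (EuclideanSpace.single 2 1) 0 * fderiv ℝ (u p.1) y (EuclideanSpace.single 0 1) 2 +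
              fderiv ℝ (u p.1) y (EuclideanSpace.single 2 1) 1 * fderiv ℝ (u p.1) y (EuclideanSpace.single 1 1) 2) /
            (fderiv ℝ (u p.1) y (EuclideanSpace.single 0 1) 2 ^ 2 + fderiv ℝ (u p.1) y (EuclideanSpace.single 1 1) 2 ^ 2)) p.2 (EuclideanSpace.single 0 1) * fderiv ℝ (u p.1) p.2 (EuclideanSpace.single 0 1) 2 +
          fderiv ℝ (fun y => (fderiv ℝ (u p.1) y (EuclideanSpace.single 2 1) 0 * fderiv ℝ (u p.1) y (EuclideanSpace.single 0 1) 2 +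
              fderiv ℝ (u p.1) y (EuclideanSpace.single 2 1) 1 * fderiv ℝ (u p.1) y (EuclideanSpace.single 1 1) 2) /
            (fderiv ℝ (u p.1) y (EuclideanSpace.single 0 1) 2 ^ 2 + fderiv ℝ (u p.1) y (EuclideanSpace.single 1 1) 2 ^ 2)) p.2 (EuclideanSpace.single 1 1) * fderiv ℝ (u p.1) p.2 (EuclideanSpace.single 1 1) 2 ≠ 0) →
        False :=
  localThickLeaf_of_localThickOpen (localThickOpen_of_localThickTH hS2)

end Summit.NavierStokesRegularity.NavierStokesRegularity.Theorems.PoloidalWindowDoorPoloidalWindowRigidityLocalThickLeafOfLocalThickTH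

end
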